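import Mathlib
import Summits.NavierStokesRegularity.NavierStokesRegularity.Theorems.EulerZoomLiouvillePowerGaugeEulerLiouvilleSelfSimilarSwirlBudgetTools
import Summits.NavierStokesRegularity.NavierStokesRegularity.Theorems.EulerZoomLiouvillePowerGaugeEulerLiouvilleSelfSimilarSwirlBudgetCylinderMax
import HarnessLib

/-!
# Crux E `PowerGaugeEulerLiouville` (stmt-NavierStokesRegularity-19832), THE ONE STATEMENT `stub_selfSimilarC2Needle`, target T1:
# «THE AXISYMMETRIC NEEDLE HAS NO SWIRL» (3/4) — the two face estimates: a fast circle about the axis costs gradient energy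
# (width seat ns-ezl-w3 g4)

Route №10 `EulerZoomLiouville` (NavierStokesRegularity), crux E; LEAD ns-typeII-p2 g12.  KERNEL ESTIMATES for a `C¹` AXISYMMETRIC field `U` on `E³`
(no Euler content).  By axisymmetry a speed floor `‖U‖ ≥ u` at ONE point `(r, 0, h)` holds on the whole circle of radius `r` about the axis at height `h`;
a family of straight lines leaving that circle inside a face of controlled energy then pays for `u` (the line-family capacity bound
`SwirlBudget.sq_mul_mul_le_of_lineFamily` of the tools file):

* **`top_face_estimate`** — circle of radius `0 < r ≤ 2L` in the horizontal plane `z = h`, `|h| ≤ 4L`; lines in the `x₀`-direction from the circle points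
  `(√(r²−t²), t, h)`, `|t| ≤ r`, to `x₀ = τ ∈ [2L, 3L]`:  `r · L · u² ≤ Ψ_A(h) + 3L² · Ψ_E(h)`, where `Ψ_A(h) = ∫⁻_t ∫⁻_s 𝟙_{B(0,6L)}‖U‖²(s,t,h)` and
  `Ψ_E(h)` = the same with `‖DU‖²` are the (truncated) PLANE integrals at height `h`;
* **`lateral_face_estimate`** — circle of radius `0 < R ≤ 2L` at height `|z₀| ≤ 4L` on the cylinder `{r = R}`; vertical lines from the circle points
  `(R cos θ, R sin θ, z₀)` to heights `τ ∈ [4L, 5L]`:  `π · L · u² ≤ Φ_A(R) + 9L² · Φ_E(R)`, where `Φ_A(R) = ∫⁻_{θ∈(−π,π)} ∫⁻_z 𝟙_{B(0,6L)}‖U‖²(R cos θ, R sin θ, z)`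
  and `Φ_E(R)` likewise are the CYLINDER integrals (in `dθ dz`; the Jacobian `R` is kept outside, cf. `lintegral_eq_lintegral_cylindrical_radial`).

The first is the budget form of «a swirl channel through a horizontal face is an expensive ring»; the second of «a fast ring far from the axis is
unaffordable».  WHAT THIS IS NOT: not NS regularity, not the crux E — tools for a portrait stratum of the crux CLASS 19832 (MODEL lattice; E/NS strata),
`--supports` stmt-19832; 19832 OPEN. [folklore: FTC along lines + AM–GM + Tonelli]
-/

noncomputable section

-- flat `Theorems/<Route><Decl>…` files of one crux share the namespace of the crux (tree convention: `Summit.<S>.<S>.…`)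
set_option linter.dupNamespace false

open MeasureTheory Set Filter Topology Metric Function
open scoped RealInnerProductSpace NNReal ENNReal

namespace Summit.NavierStokesRegularity.NavierStokesRegularity.Theorems.PowerGaugeEulerLiouville

namespace SwirlBudget

open Literature.Analysis Literature.Analysis.FluidPDE

variable {U : EuclideanSpace ℝ (Fin 3) → EuclideanSpace ℝ (Fin 3)}

/-! ### The top / bottom face: x-lines from a circle in a horizontal plane -/

/-- **TOP-FACE ESTIMATE.**  `U ∈ C¹(E³, E³)` axisymmetric, `0 < L`, `0 < r ≤ 2L`, `|h| ≤ 4L`, and `‖U(r, 0, h)‖ ≥ u > 0` (so `‖U‖ ≥ u` on the whole circle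
of radius `r` at height `h`).  If the truncated plane integrals at height `h` satisfy `∫⁻_t ∫⁻_s 𝟙_{B(0,6L)}‖U‖²(s,t,h) ≤ X_A` and
`∫⁻_t ∫⁻_s 𝟙_{B(0,6L)}‖DU‖²(s,t,h) ≤ X_E`, then `r · L · u² ≤ X_A + 3L² · X_E`.  (For `|t| ≤ r` the circle point `R_{arcsin(t/r)}(r,0,h) = (√(r²−t²), t, h)`
starts the `x₀`-line to `(τ, t, h)`, `τ ∈ [2L, 3L]`: `u ≤ ‖U(τ,t,h)‖ + ∫_0^{3L}‖DU(ξ,t,h)‖dξ`; then `sq_mul_mul_le_of_lineFamily` with `|S| = 2r`, `|T| = L`,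
`|J| = 3L`.) [folklore] -/
theorem top_face_estimate (hU1 : ContDiff ℝ 1 U) (hax : IsAxisymmetric U) {L r h u : ℝ} (hL : 0 < L)
    (hr0 : 0 < r) (hr : r ≤ 2 * L) (hh : |h| ≤ 4 * L) (hu0 : 0 < u)
    (hu : u ≤ ‖U (WithLp.toLp 2 ![r, 0, h])‖) {XA XE : ℝ} (hXA0 : 0 ≤ XA) (hXE0 : 0 ≤ XE)
    (hA : ∫⁻ t : ℝ, ∫⁻ s : ℝ, (ball (0 : EuclideanSpace ℝ (Fin 3)) (6 * L)).indicator (fun y => ‖U y‖ₑ ^ 2)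
      (WithLp.toLp 2 ![s, t, h]) ≤ ENNReal.ofReal XA)
    (hE : ∫⁻ t : ℝ, ∫⁻ s : ℝ, (ball (0 : EuclideanSpace ℝ (Fin 3)) (6 * L)).indicator (fun y => ‖fderiv ℝ U y‖ₑ ^ 2)
      (WithLp.toLp 2 ![s, t, h]) ≤ ENNReal.ofReal XE) :
    r * L * u ^ 2 ≤ XA + 3 * L ^ 2 * XE := by
  have hUc : Continuous U := hU1.continuous
  have hDUc : Continuous (fderiv ℝ U) := hU1.continuous_fderiv one_ne_zero
  -- `|x| ≤ c ⇒ x² ≤ c²` (cf. `…PerpetualPumpAveragedTypeIBlowup.slavedLadder_sq_le`)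
  have sq_le_sq_of_abs_le : ∀ {x c : ℝ}, |x| ≤ c → x ^ 2 ≤ c ^ 2 := fun {x c} h => by
    nlinarith [abs_nonneg x, sq_abs x, abs_le.1 h]
  -- the two densities along the family of `x₀`-lines, indexed by `t` (the line) and the abscissa
  set f : ℝ → ℝ → ℝ≥0∞ := fun t τ => ‖U (WithLp.toLp 2 ![τ, t, h])‖ₑ with hf
  set g : ℝ → ℝ → ℝ≥0∞ := fun t ξ => ‖fderiv ℝ U (WithLp.toLp 2 ![ξ, t, h])‖ₑ with hg
  have hpl : Continuous fun p : ℝ × ℝ => (WithLp.toLp 2 ![p.2, p.1, h] : EuclideanSpace ℝ (Fin 3)) :=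
    continuous_cartesianPt.comp (continuous_snd.prodMk (continuous_fst.prodMk continuous_const))
  have hfm : Measurable (uncurry f) := (hUc.comp hpl).measurable.enorm
  have hgm : Measurable (uncurry g) := (hDUc.comp hpl).measurable.enorm
  -- points of the lines lie in the ball `B(0, 6L)`
  have hh2 : h ^ 2 ≤ (4 * L) ^ 2 := sq_le_sq_of_abs_le hh
  have hball : ∀ s t : ℝ, |s| ≤ 3 * L → |t| ≤ r →
      (WithLp.toLp 2 ![s, t, h] : EuclideanSpace ℝ (Fin 3)) ∈ ball (0 : EuclideanSpace ℝ (Fin 3)) (6 * L) := by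
    intro s t hs ht
    apply cart_mem_ball (by positivity)
    have hs2 : s ^ 2 ≤ (3 * L) ^ 2 := sq_le_sq_of_abs_le hs
    have ht2 : t ^ 2 ≤ r ^ 2 := sq_le_sq_of_abs_le ht
    nlinarith
  -- (1) the pointwise line bound
  have hpt : ∀ t ∈ Icc (-r) r, ∀ τ ∈ Icc (2 * L) (3 * L), ENNReal.ofReal u ≤ f t τ + ∫⁻ ξ in Icc 0 (3 * L), g t ξ := by
    intro t ht τ hτ
    -- the circle point with ordinate `t`
    set φ : ℝ := Real.arcsin (t / r) with hφ
    have htr : -1 ≤ t / r ∧ t / r ≤ 1 := by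
      constructor
      · rw [le_div_iff₀ hr0]; linarith [ht.1]
      · rw [div_le_iff₀ hr0]; linarith [ht.2]
    have hsin : r * Real.sin φ = t := by rw [hφ, Real.sin_arcsin htr.1 htr.2]; field_simp
    set x₀ : ℝ := r * Real.cos φ with hx₀
    have hcos0 : 0 ≤ Real.cos φ := by rw [hφ, Real.cos_arcsin]; exact Real.sqrt_nonneg _
    have hcos1 : Real.cos φ ≤ 1 := Real.cos_le_one φ
    have hx₀0 : 0 ≤ x₀ := mul_nonneg hr0.le hcos0
    have hx₀r : x₀ ≤ r := by rw [hx₀]; nlinarith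
    have hx₀τ : x₀ ≤ τ := by linarith [hτ.1]
    set p : EuclideanSpace ℝ (Fin 3) := WithLp.toLp 2 ![0, t, h] with hp
    set e₀ : EuclideanSpace ℝ (Fin 3) := EuclideanSpace.single 0 1 with he₀
    have hq : rotZ φ (WithLp.toLp 2 ![r, 0, h]) = p + x₀ • e₀ := by
      rw [rotZ_normalForm, hsin, hp, he₀, cart_eq_add_smul_single_zero]
    have hend : (WithLp.toLp 2 ![τ, t, h] : EuclideanSpace ℝ (Fin 3)) = p + τ • e₀ := by
      rw [hp, he₀, cart_eq_add_smul_single_zero]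
    -- `u ≤ ‖U(circle point)‖ ≤ ‖U(end)‖ + ∫ ‖DU‖`
    have hu' : u ≤ ‖U (p + x₀ • e₀)‖ := by rw [← hq, norm_apply_rotZ hax]; exact hu
    have hmove := norm_sub_le_integral_norm_fderiv_line hU1 p e₀
      (by rw [he₀]; simp : ‖e₀‖ ≤ 1) hx₀τ
    have hI0 : 0 ≤ ∫ x in x₀..τ, ‖fderiv ℝ U (p + x • e₀)‖ :=
      intervalIntegral.integral_nonneg hx₀τ fun x _ => norm_nonneg _
    have hreal : u ≤ ‖U (p + τ • e₀)‖ + ∫ x in x₀..τ, ‖fderiv ℝ U (p + x • e₀)‖ :=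
      hu'.trans ((norm_le_insert _ _).trans (by linarith [hmove]))
    -- pass to `ℝ≥0∞`
    have hline_c : Continuous fun x : ℝ => ‖fderiv ℝ U (p + x • e₀)‖ :=
      (hDUc.comp (continuous_const.add (continuous_id.smul continuous_const))).norm
    have hlin : ENNReal.ofReal (∫ x in x₀..τ, ‖fderiv ℝ U (p + x • e₀)‖) ≤ ∫⁻ ξ in Icc 0 (3 * L), g t ξ := by
      refine (ofReal_intervalIntegral_le_lintegral hline_c (fun x => norm_nonneg _) hx₀τ
        (Icc_subset_Icc hx₀0 hτ.2)).trans (le_of_eq (lintegral_congr fun ξ => ?_))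
      rw [hg, ofReal_norm, hp, he₀, cart_eq_add_smul_single_zero]
    calc ENNReal.ofReal u ≤ ENNReal.ofReal (‖U (p + τ • e₀)‖ + ∫ x in x₀..τ, ‖fderiv ℝ U (p + x • e₀)‖) :=
          ENNReal.ofReal_le_ofReal hreal
      _ = ‖U (p + τ • e₀)‖ₑ + ENNReal.ofReal (∫ x in x₀..τ, ‖fderiv ℝ U (p + x • e₀)‖) := by
          rw [ENNReal.ofReal_add (norm_nonneg _) hI0, ofReal_norm]
      _ ≤ f t τ + ∫⁻ ξ in Icc 0 (3 * L), g t ξ := by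
          have e : f t τ = ‖U (p + τ • e₀)‖ₑ := by simp only [hf, hend]
          rw [e]; exact add_le_add le_rfl hlin
  -- (2) the square budgets on `S × T` and `S × J` are dominated by the truncated plane integrals
  have hA' : ∫⁻ t in Icc (-r) r, ∫⁻ τ in Icc (2 * L) (3 * L), f t τ ^ 2 ≤ ENNReal.ofReal XA := by
    refine le_trans ?_ hA
    refine (setLIntegral_mono' measurableSet_Icc fun t ht => ?_).trans (setLIntegral_le_lintegral _ _)
    refine (setLIntegral_mono' measurableSet_Icc fun τ hτ => le_of_eq ?_).trans (setLIntegral_le_lintegral _ _)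
    have hmem := hball τ t (by rw [abs_of_nonneg (by linarith [hτ.1])]; exact hτ.2) (abs_le.2 ⟨ht.1, ht.2⟩)
    rw [indicator_of_mem hmem]
  have hE' : ∫⁻ t in Icc (-r) r, ∫⁻ ξ in Icc 0 (3 * L), g t ξ ^ 2 ≤ ENNReal.ofReal XE := by
    refine le_trans ?_ hE
    refine (setLIntegral_mono' measurableSet_Icc fun t ht => ?_).trans (setLIntegral_le_lintegral _ _)
    refine (setLIntegral_mono' measurableSet_Icc fun ξ hξ => le_of_eq ?_).trans (setLIntegral_le_lintegral _ _)
    have hmem := hball ξ t (by rw [abs_of_nonneg hξ.1]; exact hξ.2) (abs_le.2 ⟨ht.1, ht.2⟩)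
    rw [indicator_of_mem hmem]
  -- (3) the line-family capacity bound
  have hvolS : volume (Icc (-r) r) = ENNReal.ofReal (2 * r) := by rw [Real.volume_Icc]; ring_nf
  have hvolT : volume (Icc (2 * L) (3 * L)) = ENNReal.ofReal L := by rw [Real.volume_Icc]; ring_nf
  have hvolJ : volume (Icc (0 : ℝ) (3 * L)) = ENNReal.ofReal (3 * L) := by rw [Real.volume_Icc]; ring_nf
  have key := sq_mul_mul_le_of_lineFamily measurableSet_Icc measurableSet_Icc hvolS hvolT hvolJ (by positivity) hL
    (by positivity) hu0 hfm hgm hpt hXA0 hXE0 hA' hE'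
  nlinarith [key]

/-! ### The lateral face: vertical lines from a circle on the cylinder `{r = R}` -/

/-- **LATERAL-FACE ESTIMATE.**  `U ∈ C¹(E³, E³)` axisymmetric, `0 < L`, `0 < R ≤ 2L`, `|z₀| ≤ 4L`, and `‖U(R, 0, z₀)‖ ≥ u > 0` (so `‖U‖ ≥ u` on the circle
`{r = R, z = z₀}`).  If the truncated cylinder integrals satisfy `∫⁻_{θ∈(−π,π)} ∫⁻_z 𝟙_{B(0,6L)}‖U‖²(R cos θ, R sin θ, z) ≤ X_A` and the same with `‖DU‖²`
`≤ X_E`, then `π · L · u² ≤ X_A + 9L² · X_E`.  (Vertical line from `R_θ(R, 0, z₀) = (R cos θ, R sin θ, z₀)` to height `τ ∈ [4L, 5L]`: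
`u ≤ ‖U(R cos θ, R sin θ, τ)‖ + ∫_{−4L}^{5L}‖DU(R cos θ, R sin θ, ξ)‖dξ`; then `sq_mul_mul_le_of_lineFamily` with `|S| = 2π`, `|T| = L`, `|J| = 9L`.)
[folklore] -/
theorem lateral_face_estimate (hU1 : ContDiff ℝ 1 U) (hax : IsAxisymmetric U) {L R z₀ u : ℝ} (hL : 0 < L)
    (hR0 : 0 < R) (hR : R ≤ 2 * L) (hz₀ : |z₀| ≤ 4 * L) (hu0 : 0 < u)
    (hu : u ≤ ‖U (WithLp.toLp 2 ![R, 0, z₀])‖) {XA XE : ℝ} (hXA0 : 0 ≤ XA) (hXE0 : 0 ≤ XE)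
    (hA : ∫⁻ θ in Ioo (-Real.pi) Real.pi, ∫⁻ z : ℝ, (ball (0 : EuclideanSpace ℝ (Fin 3)) (6 * L)).indicator (fun y => ‖U y‖ₑ ^ 2)
      (WithLp.toLp 2 ![R * Real.cos θ, R * Real.sin θ, z]) ≤ ENNReal.ofReal XA)
    (hE : ∫⁻ θ in Ioo (-Real.pi) Real.pi, ∫⁻ z : ℝ, (ball (0 : EuclideanSpace ℝ (Fin 3)) (6 * L)).indicator
      (fun y => ‖fderiv ℝ U y‖ₑ ^ 2) (WithLp.toLp 2 ![R * Real.cos θ, R * Real.sin θ, z]) ≤ ENNReal.ofReal XE) :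
    Real.pi * L * u ^ 2 ≤ XA + 9 * L ^ 2 * XE := by
  have hUc : Continuous U := hU1.continuous
  have hDUc : Continuous (fderiv ℝ U) := hU1.continuous_fderiv one_ne_zero
  have sq_le_sq_of_abs_le : ∀ {x c : ℝ}, |x| ≤ c → x ^ 2 ≤ c ^ 2 := fun {x c} h => by
    nlinarith [abs_nonneg x, sq_abs x, abs_le.1 h]
  set f : ℝ → ℝ → ℝ≥0∞ := fun θ τ => ‖U (WithLp.toLp 2 ![R * Real.cos θ, R * Real.sin θ, τ])‖ₑ with hf
  set g : ℝ → ℝ → ℝ≥0∞ := fun θ ξ => ‖fderiv ℝ U (WithLp.toLp 2 ![R * Real.cos θ, R * Real.sin θ, ξ])‖ₑ with hg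
  have hpl : Continuous fun p : ℝ × ℝ =>
      (WithLp.toLp 2 ![R * Real.cos p.1, R * Real.sin p.1, p.2] : EuclideanSpace ℝ (Fin 3)) :=
    continuous_cylindricalPt.comp (continuous_const.prodMk continuous_id)
  have hfm : Measurable (uncurry f) := (hUc.comp hpl).measurable.enorm
  have hgm : Measurable (uncurry g) := (hDUc.comp hpl).measurable.enorm
  -- points of the lines lie in the ball `B(0, 6L)`
  have hball : ∀ θ z : ℝ, |z| ≤ 5 * L →
      (WithLp.toLp 2 ![R * Real.cos θ, R * Real.sin θ, z] : EuclideanSpace ℝ (Fin 3)) ∈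
        ball (0 : EuclideanSpace ℝ (Fin 3)) (6 * L) := by
    intro θ z hz
    apply cart_mem_ball (by positivity)
    have hz2 : z ^ 2 ≤ (5 * L) ^ 2 := sq_le_sq_of_abs_le hz
    have hcs : (R * Real.cos θ) ^ 2 + (R * Real.sin θ) ^ 2 = R ^ 2 := by
      linear_combination R ^ 2 * Real.cos_sq_add_sin_sq θ
    nlinarith
  -- (1) the pointwise line bound
  have hpt : ∀ θ ∈ Ioo (-Real.pi) Real.pi, ∀ τ ∈ Icc (4 * L) (5 * L),
      ENNReal.ofReal u ≤ f θ τ + ∫⁻ ξ in Icc (-(4 * L)) (5 * L), g θ ξ := by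
    intro θ _ τ hτ
    have hz₀τ : z₀ ≤ τ := by linarith [(abs_le.1 hz₀).2, hτ.1]
    set p : EuclideanSpace ℝ (Fin 3) := WithLp.toLp 2 ![R * Real.cos θ, R * Real.sin θ, 0] with hp
    set e₂ : EuclideanSpace ℝ (Fin 3) := EuclideanSpace.single 2 1 with he₂
    have hq : rotZ θ (WithLp.toLp 2 ![R, 0, z₀]) = p + z₀ • e₂ := by
      rw [rotZ_normalForm, hp, he₂, cart_eq_add_smul_single_two]
    have hend : (WithLp.toLp 2 ![R * Real.cos θ, R * Real.sin θ, τ] : EuclideanSpace ℝ (Fin 3)) = p + τ • e₂ := by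
      rw [hp, he₂, cart_eq_add_smul_single_two]
    have hu' : u ≤ ‖U (p + z₀ • e₂)‖ := by rw [← hq, norm_apply_rotZ hax]; exact hu
    have hmove := norm_sub_le_integral_norm_fderiv_line hU1 p e₂
      (by rw [he₂]; simp : ‖e₂‖ ≤ 1) hz₀τ
    have hI0 : 0 ≤ ∫ x in z₀..τ, ‖fderiv ℝ U (p + x • e₂)‖ :=
      intervalIntegral.integral_nonneg hz₀τ fun x _ => norm_nonneg _
    have hreal : u ≤ ‖U (p + τ • e₂)‖ + ∫ x in z₀..τ, ‖fderiv ℝ U (p + x • e₂)‖ :=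
      hu'.trans ((norm_le_insert _ _).trans (by linarith [hmove]))
    have hline_c : Continuous fun x : ℝ => ‖fderiv ℝ U (p + x • e₂)‖ :=
      (hDUc.comp (continuous_const.add (continuous_id.smul continuous_const))).norm
    have hlin : ENNReal.ofReal (∫ x in z₀..τ, ‖fderiv ℝ U (p + x • e₂)‖) ≤ ∫⁻ ξ in Icc (-(4 * L)) (5 * L), g θ ξ := by
      refine (ofReal_intervalIntegral_le_lintegral hline_c (fun x => norm_nonneg _) hz₀τ
        (Icc_subset_Icc (by linarith [(abs_le.1 hz₀).1]) hτ.2)).trans (le_of_eq (lintegral_congr fun ξ => ?_))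
      rw [hg, ofReal_norm, hp, he₂, cart_eq_add_smul_single_two]
    calc ENNReal.ofReal u ≤ ENNReal.ofReal (‖U (p + τ • e₂)‖ + ∫ x in z₀..τ, ‖fderiv ℝ U (p + x • e₂)‖) :=
          ENNReal.ofReal_le_ofReal hreal
      _ = ‖U (p + τ • e₂)‖ₑ + ENNReal.ofReal (∫ x in z₀..τ, ‖fderiv ℝ U (p + x • e₂)‖) := by
          rw [ENNReal.ofReal_add (norm_nonneg _) hI0, ofReal_norm]
      _ ≤ f θ τ + ∫⁻ ξ in Icc (-(4 * L)) (5 * L), g θ ξ := by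
          have e : f θ τ = ‖U (p + τ • e₂)‖ₑ := by simp only [hf, hend]
          rw [e]; exact add_le_add le_rfl hlin
  -- (2) the square budgets are dominated by the truncated cylinder integrals
  have hA' : ∫⁻ θ in Ioo (-Real.pi) Real.pi, ∫⁻ τ in Icc (4 * L) (5 * L), f θ τ ^ 2 ≤ ENNReal.ofReal XA := by
    refine le_trans (setLIntegral_mono' measurableSet_Ioo fun θ _ => ?_) hA
    refine (setLIntegral_mono' measurableSet_Icc fun τ hτ => le_of_eq ?_).trans (setLIntegral_le_lintegral _ _)
    have hmem := hball θ τ (by rw [abs_of_nonneg (by linarith [hτ.1])]; exact hτ.2)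
    rw [indicator_of_mem hmem]
  have hE' : ∫⁻ θ in Ioo (-Real.pi) Real.pi, ∫⁻ ξ in Icc (-(4 * L)) (5 * L), g θ ξ ^ 2 ≤ ENNReal.ofReal XE := by
    refine le_trans (setLIntegral_mono' measurableSet_Ioo fun θ _ => ?_) hE
    refine (setLIntegral_mono' measurableSet_Icc fun ξ hξ => le_of_eq ?_).trans (setLIntegral_le_lintegral _ _)
    have hmem := hball θ ξ (abs_le.2 ⟨by linarith [hξ.1], hξ.2⟩)
    rw [indicator_of_mem hmem]
  -- (3) the line-family capacity bound
  have hvolS : volume (Ioo (-Real.pi) Real.pi) = ENNReal.ofReal (2 * Real.pi) := by rw [Real.volume_Ioo]; ring_nf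
  have hvolT : volume (Icc (4 * L) (5 * L)) = ENNReal.ofReal L := by rw [Real.volume_Icc]; ring_nf
  have hvolJ : volume (Icc (-(4 * L)) (5 * L)) = ENNReal.ofReal (9 * L) := by rw [Real.volume_Icc]; ring_nf
  have key := sq_mul_mul_le_of_lineFamily measurableSet_Ioo measurableSet_Icc hvolS hvolT hvolJ (by positivity) hL
    (by positivity) hu0 hfm hgm hpt hXA0 hXE0 hA' hE'
  nlinarith [key, Real.pi_pos]

end SwirlBudget

end Summit.NavierStokesRegularity.NavierStokesRegularity.Theorems.PowerGaugeEulerLiouville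

end
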